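import Summits.BirchSwinnertonDyer.BirchSwinnertonDyer.Theses.ThetaPartnerAtTwo
import Summits.BirchSwinnertonDyer.BirchSwinnertonDyer.Theorems.ThetaPartnerAtTwoSignedMainConjectureCMTwoRankZeroLowerOffTwoAtTwo
import Summits.BirchSwinnertonDyer.BirchSwinnertonDyer.Theorems.ThetaPartnerAtTwoSignedMainConjectureCMTwoRankZeroLowerOffTwoSplit
import Summits.BirchSwinnertonDyer.BirchSwinnertonDyer.Theorems.ThetaPartnerAtTwoSignedMainConjectureCMTwoRankZeroKatoDescentSocket
import HarnessLib

/-! # Skeleton line `rankzero` v19 (K2R0P♭; TWO stubs, both PUB/typed-fact shaped, NO derived reading) — crux K2R0P♭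
`SignedMainConjectureCMTwoRankZeroOfPubOfFlat` (item stmt-BirchSwinnertonDyer-26471; route ThetaPartnerAtTwo rev 38; lead prover bsd-wall-tp2-p2 g9, 2026-08-28;
v19 supersedes v18 046189c289d9686b / v17 0cfa613ad9f23cf6 / v16 fa53419110521fcc). v19 = w2 g4's kernel-checked FACTORISATION of (CORE♭-lower)
(`SignedLowerOffTwo.offTwoLower_of_poitouTateDeepTwoGen_of_zetaErlLower`, p623519 + …LowerOffTwoSplit.lean: the Poitou–Tate clause mentions none of
g, d, s) combined with v18's replacement of the derived clause (g)^ι by its typed K-side input: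
* `stub_poitouTateDeepTwoGen` = (S_PT)_gen: for EVERY elliptic `A/ℚ`, cyclotomic `κ` with topological generator `γ`, pinned `I = 𝐇¹_Γ(T₂A)` and every layer
  pairing family `pair` which IS the `T₂A`-adic local Tate pairing ((P3) in Literature names, `CyclotomicLayer.tatePairingPk`): ∃ m, (PT♭)_layer(m) — the
  DEEP half of the Λ-adic Poitou–Tate sequence at the local term (Kobayashi 2003 Thm 7.3 (ii); Milne ADT I.4.10 + Shapiro + limits; the tree holds the
  finite-level named fact `GaloisCohomology.poitouTate_selmerStructure_duality`). PUB-shaped; typer-fileable as ONE Literature fact, independent of CM.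
* `stub_zetaErlKSideCMTwo` = (S_ZETA)^K: for every CM class member off the unit zone, (κ, γ), f, ϖ, (L♯, L♭), Y, ht-1 𝔭′ ∌ 2, ∀ I, ∀ pair (P1)(P2)(P3):
  ∃ g hg d s, Honda (L)(TR)(GEN)(GEN₀) [tree: HONDA⁺@2] ∧ (ERL_pair) [Kato's explicit reciprocity law at finite level ON the layer pairing, K3's CORE_pair
  clause VERBATIM: `ν·P_{n,d_n}(pair n (s_n)) ≡ μ·θ_n (mod ω_n)`, μ, ν ∉ 𝔭′ — PRINT: Kato Thm 12.5 / (15.12.2)+Prop 15.9+(15.16.1) for f_A, Kobayashi (8.23)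
  / Sprung Def 3.1; ONE typer statement serves K3 and this crux] ∧ `Nonempty (KatoDescent.KSideDatum I Y s 𝔭′)` [Kato §15.1, p.254, L.15.13,
  (15.16.1), §15.15 + JLK Thm 5.7 §7.2 — the datum «CyclotomicTransport» must construct; (g)^ι follows by `KatoDescent.lengthAt_quotient_span_le_of_kSideDatum`].
Composition (kernel, no sorry of its own): v16 turnkey `SignedLowerOffTwo.signedMainConjectureCMTwoRankZero_body_of_pub_of_offTwoLower_of_flat` (p610476) ∘
`offTwoLower_of_poitouTateDeepTwoGen_of_zetaErlLower stub_poitouTateDeepTwoGen (… stub_zetaErlKSideCMTwo … with (g)^ι rebuilt …)`.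
Kernel chain behind (g)^ι (this lineage, 15 landings): Kato L.14.15 (p618102), descent ≤/= (p618804/p621204), K-side composition (p619744/p620022),
ℚ-side 12.4 (2) + adapters (p620290/p621424), transport assembly (p622014), socket + K-side datum (p621865/p622684/p622533/p623882), er2-ty1 T7 (p618607),
w2 g3/g4 doors (p615838 … p623519). BSD is not proved by any of this.
-/

set_option autoImplicit false
set_option linter.dupNamespace false

noncomputable section

open scoped Classical NumberField MatrixGroups ModularForm

open NumberField IsDedekindDomain CongruenceSubgroup WeierstrassCurve Literature Literature.NumberTheory.EllipticCurves
  Literature.NumberTheory.GaloisRepresentations Literature.NumberTheory.EllipticCurves.ModularForms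
  Literature.NumberTheory.EllipticCurves.Rank1Residual Literature.NumberTheory.EllipticCurves.IwasawaDual
  Literature.NumberTheory.EllipticCurves.Kobayashi2003 Literature.NumberTheory.EllipticCurves.Module
  Literature.NumberTheory.EllipticCurves.Kato2004 Literature.NumberTheory.EllipticCurves.Kato2004.EulerSystemValues
  Literature.NumberTheory.EllipticCurves.GreenbergSelmer Literature.NumberTheory.EllipticCurves.Sprung2012
  ZpExtension Summit.BirchSwinnertonDyer.Rank1Residual.Supersingular
  Summit.BirchSwinnertonDyer.BirchSwinnertonDyer.Theorems.SignedKatoOffTwo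

namespace Summit.BirchSwinnertonDyer.BirchSwinnertonDyer.Cruxes.SignedMainConjectureCMTwoRankZeroOfPubOfFlat.RankZero

/-- ((S_PT)_gen — the Λ-adic Poitou–Tate DEEP half at the local term, ON THE `T₂A`-adic layer pairing; every elliptic `A/ℚ`; PUB-shaped;
w2 g4's `hPT` binder of `offTwoLower_of_poitouTateDeepTwoGen_of_zetaErlLower` VERBATIM.)
[cite: Kobayashi2003, Thm. 7.3 (ii) (pp. 12–13), (7.17)–(7.21)] [cite: MilneADT2006, Ch. I, Thm. 4.10] [cite: Kato2004Asterisque, §17.13 (p. 280)] -/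
theorem stub_poitouTateDeepTwoGen :
    ∀ (v : HeightOneSpectrum (𝓞 ℚ)), ((2 : ℕ) : 𝓞 ℚ) ∈ v.asIdeal →
      ∀ (A : WeierstrassCurve ℚ) [A.IsElliptic],
        ∀ (κ : ZpExtension ℚ 2) (γ : Field.absoluteGaloisGroup ℚ),
          κ.IsCyclotomic → κ.IsTopGenerator γ →
        ∀ [ContinuousSMul ℤ_[2] (A.tateModule 2)] (I : Kato2004.IwasawaH1Data A 2 κ γ)
          (pair : ∀ n : ℕ, H1 (tateRep A 2) (κ.layerSubgroup n) →ₗ[ℤ_[2]]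
            (localLayerPointsOfEmb κ (closureEmb (K := ℚ) (v.adicCompletion ℚ)) A n →+ ℤ_[2])),
          -- (P3) in Literature names: `pair` IS the `T₂A`-adic local Tate pairing
          (∀ (n k : ℕ) (x : H1 (tateRep A 2) (κ.layerSubgroup n))
            (Q : localLayerPointsOfEmb κ (closureEmb (K := ℚ) (v.adicCompletion ℚ)) A n),
            PadicInt.toZModPow k (pair n x Q) = CyclotomicLayer.tatePairingPk A κ v n k x Q) →
        ∃ m : ℕ,
          (∀ z : localTowerPointsOfEmb κ (closureEmb (K := ℚ) (v.adicCompletion ℚ)) A →+ ℤ_[2],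
            (∀ (t : A.subgroupH1 2 κ.kerSubgroup), t ∈ signedSelmerInfty A κ 1 →
              ∀ (φ : contOneCocycles (discreteTopRep κ.kerSubgroup (A.geomPrimaryTorsion 2)))
                (Q : localPoints A (v.adicCompletion ℚ)) (k : ℕ), oneCocycleClass _ φ = t →
              ∀ hQ : 2 ^ k • Q ∈ (⨆ n, signedLocalPoints κ (v.adicCompletion ℚ) A 1 n),
              (∀ τ : localSubgroupOfEmb κ.kerSubgroup (closureEmb (K := ℚ) (v.adicCompletion ℚ)),
                pointsMapOfEmb A (closureEmb (K := ℚ) (v.adicCompletion ℚ))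
                    ((φ.1 (resGalSubgroupOfEmb κ.kerSubgroup _ τ) : A.geomPrimaryTorsion 2) : A.geomPoints) =
                  (τ : Field.absoluteGaloisGroup (v.adicCompletion ℚ)) • Q - Q) →
              (PadicInt.toZModPow k
                  (z ⟨2 ^ k • Q, KummerPoint.iSup_signedLocalPoints_le_localTowerPointsOfEmb A 2 κ 1 v hQ⟩)).val •
                ((((2 : ℚ) ^ k)⁻¹ : ℚ) : AddCircle (1 : ℚ)) = 0) →
            ∃ x : I.H, ∀ (n : ℕ) (Q : localPoints A (v.adicCompletion ℚ))
              (hQ : Q ∈ signedLocalPointsOfEmb κ (closureEmb (K := ℚ) (v.adicCompletion ℚ)) A 1 n),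
              (2 : ℤ_[2]) ^ m *
                  z ⟨Q, localLayerPointsOfEmb_le_localTowerPointsOfEmb κ _ A n (signedLocalPointsOfEmb_le κ _ A 1 n hQ)⟩ =
                pair n (I.proj n x) ⟨Q, signedLocalPointsOfEmb_le κ _ A 1 n hQ⟩) := by
  sorry

/-- ((S_ZETA)^K — Honda ∧ (ERL_pair) ∧ K-side datum; w2 g4's `hzeta` binder VERBATIM with its last conjunct (g)^ι REPLACED by
`Nonempty (KatoDescent.KSideDatum I Y s 𝔭′)`; the CM twin of the K3 lineage's CORE_pair.)
[cite: Kato2004Asterisque, Thm. 12.5 (p. 222), Prop. 15.9 (p. 258), (15.12.2), Lemma 15.13, §15.15, (15.16.1) (pp. 263–265), §15.1 (p. 251)]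
[cite: Kobayashi2003, (8.23) (p. 18), Thm. 6.3] [cite: Sprung2012, Def. 3.1, §7] [cite: JohnsonLeungKings2011, Thm. 5.7 and §7.2] -/
theorem stub_zetaErlKSideCMTwo :
    ∀ (v : HeightOneSpectrum (𝓞 ℚ)), ((2 : ℕ) : 𝓞 ℚ) ∈ v.asIdeal →
      ∀ (A : WeierstrassCurve ℚ) [A.IsElliptic] [A.IsGloballyMinimal],
        A.HasCM → A.analyticRank = 0 → GoodSS A 2 → A.frobeniusTrace 2 = 0 →
        2 ∣ A.shaOrder * A.tamagawaProduct →
        ∀ (κ : ZpExtension ℚ 2) (γ : Field.absoluteGaloisGroup ℚ),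
          κ.IsCyclotomic → κ.IsTopGenerator γ → IsCyclotomicVariable 2 γ →
        ∀ [NeZero (A.conductorNorm ℤ)] (f : CuspForm (Gamma0 (A.conductorNorm ℤ)) 2),
          IsNewformOf A f → ∀ (ϖ : ℚ), (ϖ : ℝ) * A.realPeriodRat = plusPeriod f →
        ∀ (Lplus Lminus : IwasawaAlgebra 2), IsPollackPair f 2 Lplus Lminus →
        ∀ [ContinuousSMul ℤ_[2] (A.tateModule 2)] (Y : A.FineSelmerDualData κ γ),
        ∀ 𝔭' : PrimeSpectrum (IwasawaAlgebra 2), 𝔭'.asIdeal.height = 1 →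
          PowerSeries.C (2 : ℤ_[2]) ∉ 𝔭'.asIdeal →
        ∀ (I : Kato2004.IwasawaH1Data A 2 κ γ)
          (pair : ∀ n : ℕ, H1 (tateRep A 2) (κ.layerSubgroup n) →ₗ[ℤ_[2]]
            (localLayerPointsOfEmb κ (closureEmb (K := ℚ) (v.adicCompletion ℚ)) A n →+ ℤ_[2])),
          -- (P1) projection formula
          (∀ (n : ℕ) (x : H1 (tateRep A 2) (κ.layerSubgroup (n + 1))) (Q : localPoints A (v.adicCompletion ℚ))
            (hQ : Q ∈ localLayerPointsOfEmb κ (closureEmb (K := ℚ) (v.adicCompletion ℚ)) A n),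
            pair n (layerCores (tateRep A 2) κ n x) ⟨Q, hQ⟩ =
              pair (n + 1) x ⟨Q, localLayerPointsOfEmb_mono κ (closureEmb (K := ℚ) (v.adicCompletion ℚ)) A (Nat.le_succ n) hQ⟩) →
          -- (P2) Galois invariance, for EVERY `g ∈ Γ_v`
          (∀ (n : ℕ) (g : Field.absoluteGaloisGroup (v.adicCompletion ℚ)) (y : H1 (tateRep A 2) (κ.layerSubgroup n))
            (Q : localPoints A (v.adicCompletion ℚ))
            (hQ : Q ∈ localLayerPointsOfEmb κ (closureEmb (K := ℚ) (v.adicCompletion ℚ)) A n),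
            pair n (conjMap (tateRep A 2).toTopRep (κ.layerSubgroup n) (resGalOfEmb (closureEmb (K := ℚ) (v.adicCompletion ℚ)) g) 1 y)
              ⟨g • Q, smul_mem_localLayerPointsOfEmb κ (closureEmb (K := ℚ) (v.adicCompletion ℚ)) A n g hQ⟩ = pair n y ⟨Q, hQ⟩) →
          -- (P3) residue clause: `pair` IS the `T₂A`-adic local Tate pairing (THE Weil pairings of the tree)
          (∀ (n k : ℕ) (x : H1 (tateRep A 2) (κ.layerSubgroup n))
            (Q : localLayerPointsOfEmb κ (closureEmb (K := ℚ) (v.adicCompletion ℚ)) A n),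
            PadicInt.toZModPow k (pair n x Q) =
              LayerPairing.layerPairingPk A κ v (LayerPairing.weilTowerPk A) (LayerPairing.weilTowerPk_pow A)
                (LayerPairing.weilTowerPk_add_left A) (LayerPairing.weilTowerPk_add_right A) (LayerPairing.weilTowerPk_smul A)
                n k x Q) →
        ∃ (g : Field.absoluteGaloisGroup (v.adicCompletion ℚ))
          (_ : κ.IsTopGenerator (resGalOfEmb (closureEmb (K := ℚ) (v.adicCompletion ℚ)) g))
          (d : ℕ → localPoints A (v.adicCompletion ℚ)) (s : I.H),
          (∀ n, d n ∈ localLayerPointsOfEmb κ (closureEmb (K := ℚ) (v.adicCompletion ℚ)) A n) ∧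
          (∀ n, localTraceOfEmb κ (closureEmb (K := ℚ) (v.adicCompletion ℚ)) A (n + 1) (n + 2) (d (n + 2)) = -d n) ∧
          (∀ n : ℕ, 1 ≤ n → ∀ P ∈ localLayerPointsOfEmb κ (closureEmb (K := ℚ) (v.adicCompletion ℚ)) A n,
            ∃ B ∈ AddSubgroup.closure (Set.range fun σ : Field.absoluteGaloisGroup (v.adicCompletion ℚ) ↦ σ • d n),
              ∃ P' ∈ localLayerPointsOfEmb κ (closureEmb (K := ℚ) (v.adicCompletion ℚ)) A (n - 1),
              ∃ R ∈ localLayerPointsOfEmb κ (closureEmb (K := ℚ) (v.adicCompletion ℚ)) A n, P = B + P' + 2 • R) ∧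
          (∀ P ∈ localLayerPointsOfEmb κ (closureEmb (K := ℚ) (v.adicCompletion ℚ)) A 0,
            ∃ a : ℤ, ∃ R ∈ localLayerPointsOfEmb κ (closureEmb (K := ℚ) (v.adicCompletion ℚ)) A 0, P = a • d 0 + 2 • R) ∧
          -- (ERL_pair) ON THE layer pairings: `ν·P_{n,d_n}(pair n (I.proj n s)) ≡ μ·θ_n (mod ω_n)` in `Λ ⊗ ℚ₂`, `μ, ν ∉ 𝔭'`
          (∃ μ ν : IwasawaAlgebra 2, μ ∉ 𝔭'.asIdeal ∧ ν ∉ 𝔭'.asIdeal ∧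
            ∀ n : ℕ, ∃ (m : ℕ) (q : IwasawaAlgebra 2),
              PowerSeries.C ((2 : ℚ_[2]) ^ m) *
                  (iwasawaToPowerSeries 2 μ * ((mazurTateElement f 2 n).map (algebraMap ℚ ℚ_[2]) : PowerSeries ℚ_[2]) -
                    iwasawaToPowerSeries 2 (ν * pairingSum A (localLayerPointsOfEmb κ (closureEmb (K := ℚ) (v.adicCompletion ℚ)) A n)
                      g n (d n) (pair n (I.proj n s)))) =
                iwasawaToPowerSeries 2 (((cyclotomicOmega 2 n).map (Int.castRingHom ℤ_[2]) : PowerSeries ℤ_[2]) * q)) ∧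
          -- (g)^ι REPLACED by its typed K-side input: ONE K-side datum (tower + JLK §7.2 + §15.1 + transport socket)
          Nonempty (Summit.BirchSwinnertonDyer.BirchSwinnertonDyer.Theorems.KatoDescent.KSideDatum I Y s 𝔭') := by
  sorry

/-- COMPOSITION (kernel-checked, no sorry of its own): PUB¹⁰, FLAT, `A` ↦ v16 turnkey ∘ w2 g4's split certificate, with (g)^ι rebuilt from the
K-side datum by `KatoDescent.lengthAt_quotient_span_le_of_kSideDatum`. -/
theorem SignedMainConjectureCMTwoRankZeroOfPubOfFlat_of :
    Summit.BirchSwinnertonDyer.BirchSwinnertonDyer.Theses.ThetaPartnerAtTwo.SignedMainConjectureCMTwoRankZeroOfPubOfFlat :=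
  fun hBF hmod hLrat hGZK h2 hC h412 hcork hP108 hWL hμ A _ _ hcm hr hss ha ↦
    Summit.BirchSwinnertonDyer.BirchSwinnertonDyer.Theorems.SignedLowerOffTwo.signedMainConjectureCMTwoRankZero_body_of_pub_of_offTwoLower_of_flat
      hBF hmod hLrat hGZK h2 hC h412 hcork hP108 hWL
      (Summit.BirchSwinnertonDyer.BirchSwinnertonDyer.Theorems.SignedLowerOffTwo.offTwoLower_of_poitouTateDeepTwoGen_of_zetaErlLower
        stub_poitouTateDeepTwoGen
        fun v hv B _ _ hcmB hrB hssB haB hzB κ γ hκ hγ hcv _ g hg ϖ hϖ Lp Lm hPP _ Y 𝔭' h𝔭' hp𝔭' I pair hP1 hP2 hP3 ↦ by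
          obtain ⟨gen, hgen, d, s, hL, hTR, hGEN, hGEN0, hERL, ⟨T⟩⟩ :=
            stub_zetaErlKSideCMTwo v hv B hcmB hrB hssB haB hzB κ γ hκ hγ hcv g hg ϖ hϖ Lp Lm hPP Y 𝔭' h𝔭' hp𝔭' I pair hP1 hP2 hP3
          exact ⟨gen, hgen, d, s, hL, hTR, hGEN, hGEN0, hERL,
            Summit.BirchSwinnertonDyer.BirchSwinnertonDyer.Theorems.KatoDescent.lengthAt_quotient_span_le_of_kSideDatum hγ T⟩)
      hμ A hcm hr hss ha

end Summit.BirchSwinnertonDyer.BirchSwinnertonDyer.Cruxes.SignedMainConjectureCMTwoRankZeroOfPubOfFlat.RankZero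

end
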